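import Summits.CriticalPhenomena.PercolationContinuityZ3.Theorems.Transplant.HeisenbergKCylSubcritical
import Summits.CriticalPhenomena.PercolationContinuityZ3.Theorems.Transplant.BoxProdHeisenbergZ
import HarnessLib

/-!
# `X □ Cay(H_{2k+1}(ℤ))` for every quasi-transitive `X` and every `k ≥ 2`: `θ(p_c) = 0` from the planar node alone

builds on p205010 (kernel theorem, internal audit signed; external expert review pending) — nothing in this file uses p205010.
Lane `prim-bschramm`, seat `prim-bschramm-p4` (gen 4; class map, memo `P4-GENERAL.md` §12), helper file
(`--supports stmt-CriticalPhenomena-4575`).  Product companion of `HeisenbergKCylSubcritical.lean`; pattern of `BoxProdHeisenbergZ.lean` (p221669).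

For `X` infinite connected locally finite quasi-transitive and two generator pairs `j' ≠ j` of `H_{2k+1}` (`k ≥ 2`): the product carries the
planar skeleton `(hkSkeleton j).boxProdLeft X` (p220983) whose cylinders `X × {|a_j|,|b_j| ≤ ℓ}` are strictly subcritical at `p_c` by the product
slab–quotient criterion (p221269) fed with the `a_j`-slab data (`boxProdHK_cylSubcritical`); growth dichotomy (Hutchcroft / amenable + Burton–Keane)
gives **`bsConj4_boxProdHeisenbergK_of_dropNode : SamePDropOfSkeleton → θ_{X □ H_{2k+1}}(v, p_c) = 0` at every vertex** — node only.
[cite: BenjaminiSchramm1996, Conj. 4 and §2] [cite: MartineauSevero2019, Cor. 2.2] [cite: Hutchcroft2016, Thm. 1] [cite: LyonsPeres2016, §6.1, Thm. 7.6]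
[cite: KozmaNitzan2024, §1 p. 2 (approach 1)]
-/

noncomputable section

namespace Summit.CriticalPhenomena.PercolationContinuityZ3.Theorems.Transplant

open MeasureTheory Literature.Probability.Percolation Literature.Probability.LatticeModels
open Literature.Barriers.CriticalPhenomena (IsQuasiTransitive IsGraphAmenable HasExponentialGrowth countable_of_connected_of_locallyFinite)

variable {W : Type} {k : ℕ} {j j' : Fin k}

/-! ## §1 The product skeleton and its cylinders -/

/-- **The planar skeleton of `X □ Cay(H_{2k+1})` over the pair `j` of the second factor.** [cite: KozmaNitzan2024, §4 p. 15] -/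
def boxProdHKSkeleton (X : SimpleGraph W) (hq : IsQuasiTransitive X) (j : Fin k) : PlanarSkeleton (X □ hkGraph k) :=
  (hkSkeleton j).boxProdLeft X hq

/-- Its base vertices are the `(v, 1)`. [folklore] -/
theorem snd_eq_zero_of_mem_boxProdHKSkeleton_types (X : SimpleGraph W) (hq : IsQuasiTransitive X) (j : Fin k) {t : W × HK k}
    (ht : t ∈ (boxProdHKSkeleton X hq j).types) : t.2 = 0 := by
  have h := ((PlanarSkeleton.mem_types_boxProdLeft X hq (hkSkeleton j) t).1 ht).2
  simpa using h

/-- **Its cylinders at `(x, 1)` are `X × Cyl_ℓ`.** [folklore] -/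
theorem boxProdHKSkeleton_cyl (X : SimpleGraph W) (hq : IsQuasiTransitive X) (j : Fin k) (x : W) (ℓ : ℕ) :
    (boxProdHKSkeleton X hq j).cyl (x, (0 : HK k)) ℓ = (Set.univ : Set W) ×ˢ (hkSkeleton j).cyl 0 ℓ := by
  rw [boxProdHKSkeleton, PlanarSkeleton.cyl_boxProdLeft]

/-! ## §2 Input Φ2 of the product skeleton at `p_c` -/

/-- **The cylinders `X × Cyl_ℓ` of `X □ Cay(H_{2k+1})` do not percolate at `p_c`** (`X` connected, locally finite, quasi-transitive; `j' ≠ j`):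
the product slab–quotient criterion with the `a_j`-slab `{|a_j| ≤ ℓ}` and `Γ = ⟨B_j^{2ℓ+2}⟩`. [cite: MartineauSevero2019, Cor. 2.2] -/
theorem boxProdHK_cylSubcritical (X : SimpleGraph W) [X.LocallyFinite] (hc : X.Connected) (hq : IsQuasiTransitive X) (hjj : j' ≠ j)
    (x : W) (ℓ : ℕ) :
    theta ((X □ hkGraph k).induce ((Set.univ : Set W) ×ˢ (hkSkeleton j).cyl 0 ℓ))
      ⟨(x, (0 : HK k)), Set.mk_mem_prod (Set.mem_univ x) ((hkSkeleton j).mem_cyl_self 0 ℓ)⟩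
      (criticalProbIOf (X □ hkGraph k) (x, (0 : HK k))) = 0 := by
  classical
  have hN0 : 2 * ℓ + 2 ≠ 0 := Nat.succ_ne_zero _
  exact theta_boxProd_induce_cyl_criticalProb_eq_zero X (hkGraph k) (Γ := BjShift j (2 * ℓ + 2)) (S := hkSlab j ℓ)
    hc hq (hkSkeleton_cyl_subset_hkSlab j le_rfl) (bjShift_isActionByAut j (2 * ℓ + 2) ℓ)
    (fun g y h => bjShift_free hN0 g y h) (hkSlabGraph_connected hjj) (hkSlabGraph_quasiTransitive j ℓ)
    ((hkSlabReps j ℓ).subtype (· ∈ hkSlab j ℓ)) (hkSlabShifts j ℓ) (fun τ hτ g y => hkSlabShifts_comm τ hτ g y)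
    (fun y => by
      obtain ⟨τ, hτ, hy⟩ := hkSlabShifts_cover j ℓ y
      exact ⟨τ, hτ, Finset.mem_subtype.2 hy⟩)
    (hkSlabOrigin j ℓ) (criticalProb_hkSlab_lt_one hjj ℓ) (fun g y hy hgy => bj_eq_one_of_smul_mem_cyl g y hy hgy)
    (fun g y z hy hz h => bj_eq_one_of_adj_smul_cyl g y z hy hz h) x ((hkSkeleton j).mem_cyl_self 0 ℓ)

/-- … packaged as input Φ2 of the product skeleton at `p_c` (at any base vertex). [cite: MartineauSevero2019, Cor. 2.2] -/
theorem boxProdHKSkeleton_cylSubcritical (X : SimpleGraph W) [X.LocallyFinite] (hc : X.Connected) (hq : IsQuasiTransitive X)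
    (hjj : j' ≠ j) (v : W × HK k) : (boxProdHKSkeleton X hq j).CylSubcritical (criticalProbIOf (X □ hkGraph k) v) := by
  haveI : Countable W := countable_of_connected_of_locallyFinite X hc v.1
  have hconn : (X □ hkGraph k).Connected := hc.boxProd (hkGraph_connected hjj)
  intro t' ht' ℓ
  obtain ⟨x', y'⟩ := t'
  have hy' : y' = 0 := snd_eq_zero_of_mem_boxProdHKSkeleton_types X hq j ht'
  subst hy'
  rw [theta_induce_congr (X □ hkGraph k) (boxProdHKSkeleton_cyl X hq j x' ℓ)]
  have hpc : criticalProbIOf (X □ hkGraph k) v = criticalProbIOf (X □ hkGraph k) (x', (0 : HK k)) :=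
    Subtype.ext (criticalProb_eq_of_reachable _ (hconn.preconnected _ _))
  rw [hpc]
  exact boxProdHK_cylSubcritical X hc hq hjj x' ℓ

/-! ## §3 Conjecture 4 for `X □ Cay(H_{2k+1})` from the planar node -/

/-- **`θ_{X □ Cay(H_{2k+1})}(v, p_c) = 0` at every vertex (`j' ≠ j`), from the planar DROP node** (`X` connected, locally finite,
quasi-transitive): Hutchcroft for exponential growth of `X`; otherwise amenable + Burton–Keane + product skeleton + Φ2 by §2.
Conditional on `SamePDropOfSkeleton` only. [cite: BenjaminiSchramm1996, Conj. 4] [cite: Hutchcroft2016, Thm. 1] [cite: KozmaNitzan2024, §1 p. 2] -/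
theorem bsConj4_boxProdHeisenbergK_of_dropNode (hD : SamePDropOfSkeleton) (hjj : j' ≠ j) (X : SimpleGraph W) [X.LocallyFinite]
    (hc : X.Connected) (hq : IsQuasiTransitive X) (v : W × HK k) :
    theta (X □ hkGraph k) v (criticalProbIOf (X □ hkGraph k) v) = 0 := by
  classical
  by_cases hg : HasExponentialGrowth X
  · exact theta_boxProd_criticalProb_eq_zero_of_expGrowth X (hkGraph k) hc (hkGraph_connected hjj) hq hkGraph_quasiTransitive hg v
  · have hconn : (X □ hkGraph k).Connected := hc.boxProd (hkGraph_connected hjj)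
    haveI : Countable W := countable_of_connected_of_locallyFinite X hc v.1
    have ha : IsGraphAmenable (X □ hkGraph k) :=
      isGraphAmenable_boxProd_of_polyGrowth X (hkGraph k) hq hkGraph_quasiTransitive (2 * k + 2) ballVolume_hkGraph_le hg
    obtain ⟨t, ht, -⟩ := (boxProdHKSkeleton X hq j).frame v
    have h0 : theta (X □ hkGraph k) t (criticalProbIOf (X □ hkGraph k) t) = 0 :=
      continuity_of_skeleton_drop_amenable hD (X □ hkGraph k) (boxProdHKSkeleton X hq j) hconn
        (isQuasiTransitive_boxProd hq hkGraph_quasiTransitive) ha t ht (boxProdHKSkeleton_cylSubcritical X hc hq hjj t)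
    exact theta_criticalProbIOf_eq_zero_of_reachable (X □ hkGraph k) (hconn.preconnected _ _) h0

/-- **The same for every `k ≥ 2`.** [cite: BenjaminiSchramm1996, Conj. 4] -/
theorem bsConj4_boxProdHeisenbergK_of_dropNode' (hD : SamePDropOfSkeleton) (hk : 2 ≤ k) (X : SimpleGraph W) [X.LocallyFinite]
    (hc : X.Connected) (hq : IsQuasiTransitive X) (v : W × HK k) :
    theta (X □ hkGraph k) v (criticalProbIOf (X □ hkGraph k) v) = 0 := by
  obtain ⟨j, j', hjj⟩ := exists_two_pairs hk
  exact bsConj4_boxProdHeisenbergK_of_dropNode hD hjj X hc hq v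

/-- **All hypotheses of Benjamini–Schramm's Conjecture 4 hold for `X □ Cay(H_{2k+1})`, `k ≥ 2`.** [cite: BenjaminiSchramm1996, Conj. 4 and §2] -/
theorem boxProdHeisenbergK_conj4_hypotheses (hjj : j' ≠ j) (X : SimpleGraph W) [X.LocallyFinite] (hc : X.Connected)
    (hq : IsQuasiTransitive X) (x : W) :
    (X □ hkGraph k).Connected ∧ IsQuasiTransitive (X □ hkGraph k) ∧ criticalProb (X □ hkGraph k) (x, (0 : HK k)) < 1 := by
  haveI : Countable W := countable_of_connected_of_locallyFinite X hc x
  exact ⟨hc.boxProd (hkGraph_connected hjj), isQuasiTransitive_boxProd hq hkGraph_quasiTransitive,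
    (criticalProb_boxProd_le_right X (hkGraph k) x 0).trans_lt (criticalProb_hkGraph_lt_one hjj)⟩

end Summit.CriticalPhenomena.PercolationContinuityZ3.Theorems.Transplant

end
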